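import Literature.NumberTheory.LFunctions.ConreyIwaniec2002Prop81LargeCloseOfProp64
import Literature.NumberTheory.LFunctions.ConreyIwaniec2002AFEResidualBound
import Literature.NumberTheory.LFunctions.DivisorSquareWeightedSum
import Literature.NumberTheory.LFunctions.ConreyIwaniec2002PrincipalEstimateClose
import HarnessLib

/-!
# Conrey–Iwaniec (2002), Proposition 8.1 (`_large_close`) FROM PROPOSITION 6.4 ALONE — and the odd-`q` chain

B. Conrey, H. Iwaniec, *Spacing of zeros of Hecke L-functions and the class number problem*,
Acta Arith. 103 (2002), §§5–10 [held text `paper:arxiv-math_0111012`].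

The line `prop81-afe-plancherel` closes: every stub of its skeleton is a tree theorem
(S1 `classGroupLFunction_eq_afe_all`, S2 `afeV_bounds`, S3/S4 `WeightedMeanValue.*`,
S5 `Quadratic.differentClass_eq_one_of_finrank_eq_two`, S6a `residual_meanSquare_le`,
S6b `divisorSq_weighted_tsum_le`, S6c `main_meanSquares`), so the named statement
`conreyIwaniec2002_proposition81_large_close` — Proposition 8.1 (8.10) for `1`-spaced
`S ⊂ (T, 2T]`, `T ≥ q^66`, `T ≥ e^{(log q)²}`, companions `|t′ − t| ≤ 1` — follows from the typed
Proposition 6.4 (`conreyIwaniec2002_proposition64`, the binder `h64`) ALONE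
(`conreyIwaniec2002_proposition81_large_close_of_proposition64`). Down the landed chain of
`ConreyIwaniec2002PrincipalEstimateClose` this gives, from `h64` alone: Theorem 1.1 (weak form,
`conreyIwaniec2002_theorem11_weak`), Corollary 10.2, `L(1,χ) ≥ (log q)^{−67}` under the close-zero
hypothesis of Theorem 1.1, Corollary 1.3 for odd `q` (weak), and the Dedekind-close-zero door.
No summit statement is touched. Everything PROVED; no definition.

«The programme SEARCHES and TYPES; no claim about Landau–Siegel zeros, Theorems 1–2 of
arXiv:2211.02515 or a repaired Margin232 until a kernel theorem says so.»

## References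
* [ConreyIwaniec2002] B. Conrey, H. Iwaniec, Acta Arith. 103 (2002) 259–312, arXiv:math/0111012:
  Proposition 6.4, Proposition 8.1 (8.10), Proposition 9.2, Corollary 10.2, Theorem 1.1, Corollary 1.3.
-/

noncomputable section

open scoped NumberField
open Complex

namespace Literature.NumberTheory.LFunctions

namespace ConreyIwaniec2002

open NumberField

/-- **CI PROPOSITION 8.1 (`_large_close`) FROM PROPOSITION 6.4.** The named statement
`conreyIwaniec2002_proposition81_large_close` holds given the typed Proposition 6.4 — the whole
`prop81-afe-plancherel` line (S1–S6) is in the tree. [cite: ConreyIwaniec2002, Proposition 8.1 (8.10)] -/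
theorem conreyIwaniec2002_proposition81_large_close_of_proposition64
    (h64 : conreyIwaniec2002_proposition64) : conreyIwaniec2002_proposition81_large_close :=
  prop81_large_close_of_prop64_residual_divisor h64 residual_meanSquare_le divisorSq_weighted_tsum_le

/-- **CI THEOREM 1.1 (weak form) FROM PROPOSITION 6.4 ALONE.** [cite: ConreyIwaniec2002, Theorem 1.1 (1.21)] -/
theorem theorem11_weak_of_proposition64 (h64 : conreyIwaniec2002_proposition64) :
    conreyIwaniec2002_theorem11_weak :=
  theorem11_weak_of_prop81_large_close (conreyIwaniec2002_proposition81_large_close_of_proposition64 h64)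

/-- **CI COROLLARY 10.2 FROM PROPOSITION 6.4 ALONE.** [cite: ConreyIwaniec2002, Corollary 10.2] -/
theorem corollary102_of_proposition64 (h64 : conreyIwaniec2002_proposition64) :
    conreyIwaniec2002_corollary102 :=
  corollary102_of_prop81_large_close (conreyIwaniec2002_proposition81_large_close_of_proposition64 h64)

/-- **`L(1,χ) ≥ (log q)^{−67}` FROM PROPOSITION 6.4 ALONE** (under the close-zero hypothesis of
Theorem 1.1, odd `q`). [cite: ConreyIwaniec2002, Theorem 1.1 (remark after (1.21))] -/
theorem lOne_ge_log_pow_neg_67_of_proposition64 (h64 : conreyIwaniec2002_proposition64) :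
    ∃ c : ℝ, 0 < c ∧
      ∀ (q : ℕ) [NeZero q], 4 < q → Odd q → ∀ χ : DirichletCharacter ℂ q,
        χ.IsPrimitive → χ.IsQuadratic → χ.Odd →
          ∀ (K : Type) [Field K] [NumberField K],
            Module.finrank ℚ K = 2 → NumberField.discr K = -(q : ℤ) →
              ∀ (ψ : ClassGroup (𝓞 K) →* ℂˣ) (T α : ℝ), 2 ≤ T → 0 < α → α ≤ 1 →
                Real.log T = Real.log q ^ (18 : ℝ) →
                  α⁻¹ * c * T * Real.log T ^ ((1 : ℝ) / 3) ≤
                      (closeZeroCount (classGroupLFunction K ψ) α T : ℝ) →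
                    Real.log q ^ (-(67 : ℝ)) ≤ ‖χ.LFunction 1‖ :=
  lOne_ge_log_pow_neg_67_of_prop81_large_close
    (conreyIwaniec2002_proposition81_large_close_of_proposition64 h64)

/-- **CI COROLLARY 1.3 FOR ODD `q` (weak, `c′(log q)^{−19}`) FROM PROPOSITION 6.4 ALONE.**
[cite: ConreyIwaniec2002, Corollary 1.3] -/
theorem corollary13_odd_weak_of_proposition64 (h64 : conreyIwaniec2002_proposition64) :
    ∃ c₁ : ℝ, 0 < c₁ ∧ ∃ c' : ℝ, 0 < c' ∧
      ∀ (q : ℕ) [NeZero q], 4 < q → Odd q → ∀ χ : DirichletCharacter ℂ q,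
        χ.IsPrimitive → χ.IsQuadratic → χ.Odd →
          ∀ (K : Type) [Field K] [NumberField K],
            Module.finrank ℚ K = 2 → NumberField.discr K = -(q : ℤ) →
              ∀ (ψ : ClassGroup (𝓞 K) →* ℂˣ) (S : Finset ℝ),
                IsPointSet S (Real.exp (Real.log q ^ (6 : ℕ))) →
                  (∀ t ∈ S, ‖deriv (classGroupLFunction K ψ) (1 / 2 + t * I)‖ ≤
                      Real.log q ^ ((7 : ℝ) / 2)) →
                    c₁ * Real.exp (Real.log q ^ (6 : ℕ)) ≤ (S.card : ℝ) →
                      c' * Real.log q ^ (-(19 : ℝ)) ≤ ‖χ.LFunction 1‖ :=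
  corollary13_odd_weak_of_prop81_large_close
    (conreyIwaniec2002_proposition81_large_close_of_proposition64 h64)

/-- **THE DEDEKIND-CLOSE-ZERO DOOR FROM PROPOSITION 6.4 ALONE**: `H_K(A, α)` and Proposition 6.4 give
`L(1,χ) ≥ ¼ (log q)^{−(4A+19)}` for all large odd `q`. [cite: ConreyIwaniec2002, Theorem 1.1 (1.21)] -/
theorem lOne_lowerBound_of_dedekindCloseZero_of_proposition64 {A α : ℝ} (hA : 0 ≤ A)
    (hα : 0 < α) (hα1 : α ≤ 1) (h64 : conreyIwaniec2002_proposition64)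
    (h : DedekindCloseZeroHypothesis A α) :
    ∃ q₀ : ℕ, ∀ (q : ℕ) [NeZero q], q₀ ≤ q → 4 < q → Odd q →
      ∀ χ : DirichletCharacter ℂ q, χ.IsPrimitive → χ.IsQuadratic → χ.Odd →
        ∀ (K : Type) [Field K] [NumberField K],
          Module.finrank ℚ K = 2 → NumberField.discr K = -(q : ℤ) →
            (1 / 4) * Real.log q ^ (-(4 * A + 19)) ≤ ‖χ.LFunction 1‖ :=
  lOne_lowerBound_of_dedekindCloseZero_of_prop81_large_close hA hα hα1
    (conreyIwaniec2002_proposition81_large_close_of_proposition64 h64) h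

/-! ### The §9 doors from Proposition 6.4 alone (inputs I6 / I6b by name)

Proposition 9.1 (9.7) in the range of its printed proof (`q^66 ≤ T`, `e^{(log q)²} ≤ T`,
companions `|t′(t) − t| ≤ 1`) and Proposition 9.2 (9.12) — with `(log q)^{7/2}` fact-free, and AS
TYPED given the printed (9.11) claim — from the single remaining printed input, Proposition 6.4.
One-line discharges of `prop91_close_of`, `proposition92_weak_of_prop81_large_close`,
`proposition92_of_prop81_large_close` (`ConreyIwaniec2002PrincipalEstimateClose`). -/

/-- **CI PROPOSITION 9.1 (9.7) — `1`-spaced `S ⊂ (T,2T]`, `q^66 ≤ T`, `e^{(log q)²} ≤ T`,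
companions `|t′(t) − t| ≤ 1` — FROM PROPOSITION 6.4 ALONE** (conclusion VERBATIM that of
`prop91_close_of`; Corollary 6.3 in the large range, Lemma 7.5, the bilinear mean value, the
mollifier identity and mean square are tree theorems). [cite: ConreyIwaniec2002, Proposition 9.1 (9.7)] -/
theorem prop91_close_of_proposition64 (h64 : conreyIwaniec2002_proposition64) :
    ∃ C : ℝ, 0 < C ∧
    ∀ (q : ℕ) [NeZero q], 4 < q → Odd q → ∀ χ : DirichletCharacter ℂ q,
      χ.IsPrimitive → χ.IsQuadratic → χ.Odd →
        ∀ (K : Type) [Field K] [NumberField K],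
          Module.finrank ℚ K = 2 → NumberField.discr K = -(q : ℤ) →
            ∀ (ψ : ClassGroup (𝓞 K) →* ℂˣ) (T : ℝ) (S : Finset ℝ) (t' : ℝ → ℝ),
              (q : ℝ) ^ (66 : ℕ) ≤ T → Real.exp (Real.log q ^ (2 : ℕ)) ≤ T → IsDyadicPointSet S T →
                (∀ t ∈ S, |t' t - t| ≤ 1) →
                defectE K ψ q S t' ≤
                  C * (T * Real.log q ^ (6 : ℕ) +
                    T * Real.sqrt (calL χ T) * Real.log T ^ (2 : ℕ) * Real.log q ^ ((5 : ℝ) / 2)) :=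
  prop91_close_of (conreyIwaniec2002_proposition81_large_close_of_proposition64 h64)

/-- **CI PROPOSITION 9.2 (9.12) WITH `(log q)^{7/2}` (fact-free in (9.11)) FROM PROPOSITION 6.4
ALONE** (conclusion VERBATIM that of `proposition92_weak_of_prop81_large_close` and of
`conreyIwaniec2002_proposition92_weak_of_proposition81`). [cite: ConreyIwaniec2002, Proposition 9.2 (9.12)] -/
theorem proposition92_weak_of_proposition64 (h64 : conreyIwaniec2002_proposition64) :
    ∃ C : ℝ, 0 < C ∧
    ∀ (q : ℕ) [NeZero q], 4 < q → Odd q → ∀ χ : DirichletCharacter ℂ q,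
      χ.IsPrimitive → χ.IsQuadratic → χ.Odd →
        ∀ (K : Type) [Field K] [NumberField K],
          Module.finrank ℚ K = 2 → NumberField.discr K = -(q : ℤ) →
            ∀ (ψ : ClassGroup (𝓞 K) →* ℂˣ) (T : ℝ) (S : Finset ℝ) (t' : ℝ → ℝ),
              2 ≤ T → IsPointSet S T →
                ∑ t ∈ S, sincTerm t (t' t) ≤
                  C * (T / Real.log T * Real.log q ^ (6 : ℕ) +
                    T * Real.log T * Real.sqrt ‖χ.LFunction 1‖ * Real.log q ^ ((7 : ℝ) / 2) +
                    Real.log q ^ ((5 : ℝ) / 2) / Real.log T *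
                      Real.sqrt (T * ∑ t ∈ S, ‖dividedDifference (classGroupLFunction K ψ)
                        (1 / 2 + t * I) (1 / 2 + t' t * I)‖ ^ 2)) :=
  proposition92_weak_of_prop81_large_close
    (conreyIwaniec2002_proposition81_large_close_of_proposition64 h64)

/-- **CI PROPOSITION 9.2 AS TYPED (`conreyIwaniec2002_proposition92`, BY NAME) FROM PROPOSITION 6.4,
given the printed (9.11) claim `hLq`** (HONEST LABEL, as in `proposition92_of_prop81_large_close`:
`ℒ(T) ≪ L(1,χ) log q` when `(log T)·L(1,χ)^{1/2}(log q)³ ≤ 1`, i.e. `|L′(1,χ)| ≪ log q` in the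
exceptional regime — open, NOT proved here). [cite: ConreyIwaniec2002, Proposition 9.2 (9.12), (9.11)] -/
theorem proposition92_of_proposition64 (h64 : conreyIwaniec2002_proposition64)
    (hLq : ∃ C : ℝ, 0 < C ∧
      ∀ (q : ℕ) [NeZero q], 4 < q → ∀ χ : DirichletCharacter ℂ q,
        χ.IsPrimitive → χ.IsQuadratic → χ.Odd → ∀ T : ℝ, 2 ≤ T →
          Real.log T * Real.sqrt ‖χ.LFunction 1‖ * Real.log q ^ (3 : ℕ) ≤ 1 →
            calL χ T ≤ C * (‖χ.LFunction 1‖ * Real.log q)) :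
    conreyIwaniec2002_proposition92 :=
  proposition92_of_prop81_large_close
    (conreyIwaniec2002_proposition81_large_close_of_proposition64 h64) hLq

end ConreyIwaniec2002

end Literature.NumberTheory.LFunctions
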